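import Summits.RiemannHypothesis.RiemannHypothesis.Theorems.Splittings.SplitXWucK1RB
import HarnessLib

/-!
# Splittings — x-wuc GEN-11 `SplitXWucK1R` (K1′(ℝ) AT THE STAKE) — mechanical carve part 3/14
Continuation of `Summits.RiemannHypothesis.RiemannHypothesis.Theorems.Splittings.SplitXWucK1RB`: byte-identical declaration units of the referee-passed extract `SplitXWucK1R.lean`
sha16 70c8eb2af2868881 (x-wuc g11; ref g10 PASS 2026-08-27T22:59:46Z; RULING #330); open namespaces/sections re-opened with their context.
HONEST LABEL: splitting search over kernel-typed RH-equivalences; K-CERT′ (complex `f`) stays OPEN; nothing here bears on the truth of RH.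
-/
set_option linter.dupNamespace false
noncomputable section
open scoped Classical ComplexConjugate
open Set Filter Topology Complex MeasureTheory
open Real Set Filter Topology
open Real Set MeasureTheory Complex Filter Topology
open scoped Real
namespace Summit.RiemannHypothesis.RiemannHypothesis.Theorems.Splittings.XWucG8.CoshKernel
section dent
/-- the transform at level `κ` is the `c_n`-weighted sum of the `π ℤ`-translates at level `0`. -/
theorem hasSum_tfT (f : ℝ → ℂ) (hf : Continuous f) (κ : ℝ) (hκ : 0 < κ) (x : ℝ) :
    HasSum (fun n : ℤ => (cc κ n : ℂ) * tfT f (x + π * n) 0) (tfT f x κ) := by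
  haveI : Fact ((0 : ℝ) < 2) := ⟨two_pos⟩
  obtain ⟨B, hB⟩ := IsCompact.exists_bound_of_continuousOn isCompact_Icc
    (hf.continuousOn : ContinuousOn f (Icc (-1 : ℝ) 1))
  have hB0 : 0 ≤ B := (norm_nonneg _).trans (hB 0 ⟨by norm_num, by norm_num⟩)
  simp_rw [tfT_interval]
  simp_rw [← intervalIntegral.integral_const_mul]
  have hIoc : ∀ t : ℝ, t ∈ Set.uIoc (-1 : ℝ) 1 → t ∈ Icc (-1 : ℝ) 1 := by
    intro t ht
    rw [Set.uIoc_of_le (by norm_num)] at ht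
    exact ⟨ht.1.le, ht.2⟩
  refine intervalIntegral.hasSum_integral_of_dominated_convergence
    (fun n _ => ‖(cc κ n : ℂ)‖ * B) ?_ ?_ ?_ ?_ ?_
  · intro n
    apply Continuous.aestronglyMeasurable
    fun_prop
  · intro n
    refine Filter.Eventually.of_forall (fun t ht => ?_)
    rw [norm_mul, norm_mul, norm_mul, norm_cexp_I_mul, mul_one, zero_mul, Real.cosh_zero,
      Complex.ofReal_one, norm_one, mul_one]
    exact mul_le_mul_of_nonneg_left (hB t (hIoc t ht)) (norm_nonneg _)
  · exact Filter.Eventually.of_forall (fun t _ => (summable_norm_cc κ hκ).mul_right B)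
  · exact intervalIntegrable_const
  · refine Filter.Eventually.of_forall (fun t ht => ?_)
    have h := (hasSum_cosh κ hκ (hIoc t ht)).mul_left (f t * cexp (I * (x : ℂ) * t))
    have e1 : ∀ n : ℤ, (cc κ n : ℂ) * (f t * (Real.cosh (0 * t) : ℂ) * cexp (I * ((x + π * n : ℝ) : ℂ) * t))
        = f t * cexp (I * (x : ℂ) * t) * ((cc κ n : ℂ) * cexp (π * n * t * I)) := by
      intro n
      rw [zero_mul, Real.cosh_zero, Complex.ofReal_one, mul_one,
        show cexp (I * ((x + π * n : ℝ) : ℂ) * t) = cexp (I * (x : ℂ) * t) * cexp (π * n * t * I) by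
          rw [← Complex.exp_add]; congr 1; push_cast; ring]
      ring
    have e2 : f t * (Real.cosh (κ * t) : ℂ) * cexp (I * (x : ℂ) * t)
        = f t * cexp (I * (x : ℂ) * t) * (Real.cosh (κ * t) : ℂ) := by ring
    simp_rw [e1, e2]
    exact h

/-- **Cosh kernel dent lemma** (blueprint step (1)):
`‖T(x, κ) - (sinh κ/κ) T(x, 0)‖ ≤ (cosh κ - sinh κ/κ) · M` whenever `‖T(y, 0)‖ ≤ M` for all `y`. -/
theorem norm_tfT_sub_le (f : ℝ → ℂ) (hf : Continuous f) (κ : ℝ) (hκ : 0 < κ) (M : ℝ)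
    (hM : ∀ y : ℝ, ‖tfT f y 0‖ ≤ M) (x : ℝ) :
    ‖tfT f x κ - (Real.sinh κ / κ : ℝ) * tfT f x 0‖ ≤ (Real.cosh κ - Real.sinh κ / κ) * M := by
  haveI : Fact ((0 : ℝ) < 2) := ⟨two_pos⟩
  set s : ℤ → ℂ := fun n => (cc κ n : ℂ) * tfT f (x + π * n) 0 with hs_def
  have hs : HasSum s (tfT f x κ) := hasSum_tfT f hf κ hκ x
  have hs0 : s 0 = (Real.sinh κ / κ : ℝ) * tfT f x 0 := by
    simp only [hs_def, Int.cast_zero, mul_zero, add_zero, cc_zero κ hκ]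
  have h1 : HasSum (fun n : ℤ => if n = 0 then s 0 else 0) (s 0) := hasSum_ite_eq 0 (s 0)
  have h2 := hs.sub h1
  -- comparison series
  set g : ℤ → ℝ := fun n => if n = 0 then 0 else ‖(cc κ n : ℂ)‖ * M with hg_def
  have hle : ∀ n : ℤ, ‖s n - (if n = 0 then s 0 else 0)‖ ≤ g n := by
    intro n
    by_cases hn : n = 0
    · subst hn; simp [hg_def]
    · simp only [hn, if_false, sub_zero, hg_def, hs_def, norm_mul]
      exact mul_le_mul_of_nonneg_left (hM _) (norm_nonneg _)
  have hc0 : ‖(cc κ 0 : ℂ)‖ = Real.sinh κ / κ := by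
    rw [norm_cc κ hκ]; simp; field_simp
  have hg : HasSum g ((Real.cosh κ - Real.sinh κ / κ) * M) := by
    have h3 := ((hasSum_norm_cc κ hκ).sub (hasSum_ite_eq (0 : ℤ) ‖(cc κ 0 : ℂ)‖)).mul_right M
    rw [hc0] at h3
    have e3 : g = fun i : ℤ => (‖(cc κ i : ℂ)‖ - if i = 0 then Real.sinh κ / κ else 0) * M := by
      funext n
      by_cases hn : n = 0
      · subst hn; simp only [hg_def, if_true, hc0, sub_self, zero_mul]
      · simp [hg_def, hn]
    rw [e3]; exact h3
  have hsumm : Summable (fun n : ℤ => ‖s n - (if n = 0 then s 0 else 0)‖) :=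
    Summable.of_nonneg_of_le (fun n => norm_nonneg _) hle hg.summable
  rw [← hs0, ← h2.tsum_eq]
  calc ‖∑' n : ℤ, (s n - if n = 0 then s 0 else 0)‖
      ≤ ∑' n : ℤ, ‖s n - (if n = 0 then s 0 else 0)‖ := norm_tsum_le_tsum_norm hsumm
    _ ≤ ∑' n : ℤ, g n := Summable.tsum_le_tsum hle hsumm hg.summable
    _ = (Real.cosh κ - Real.sinh κ / κ) * M := hg.tsum_eq

end dent
end Summit.RiemannHypothesis.RiemannHypothesis.Theorems.Splittings.XWucG8.CoshKernel
namespace Summit.RiemannHypothesis.RiemannHypothesis.Theorems.Splittings.XWucG8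
end Summit.RiemannHypothesis.RiemannHypothesis.Theorems.Splittings.XWucG8
open Real Set MeasureTheory Complex Filter Topology
open scoped Real
namespace Summit.RiemannHypothesis.RiemannHypothesis.Theorems.Splittings.XWucG8
namespace DSLine
section engine
variable [hT : Fact ((0 : ℝ) < 2)]
/-- a continuous kernel on `[-1,1]` with matching end values, made 2-periodic. -/
noncomputable def kerLift (K : ℝ → ℂ) (hK : Continuous K) (hper : K (-1) = K 1) : C(AddCircle (2 : ℝ), ℂ) :=
  ⟨AddCircle.liftIco 2 (-1) K,
    AddCircle.liftIco_continuous (by rw [show (-1 : ℝ) + 2 = 1 by norm_num]; exact hper) hK.continuousOn⟩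

/-- `kerLift_apply` — helper of the x-wuc GEN-11 chain «K1′(ℝ) at the stake» (verbatim from the referee-passed extract `SplitXWucK1R.lean` 70c8eb2af2868881; role: see the module docstring). -/
theorem kerLift_apply (K : ℝ → ℂ) (hK : Continuous K) (hper : K (-1) = K 1) {u : ℝ}
    (hu : u ∈ Icc (-1 : ℝ) 1) : kerLift K hK hper (u : AddCircle (2 : ℝ)) = K u := by
  rcases eq_or_lt_of_le hu.2 with h | h
  · subst h
    have h1 : ((1 : ℝ) : AddCircle (2 : ℝ)) = ((-1 : ℝ) : AddCircle (2 : ℝ)) := by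
      have := AddCircle.coe_add_period (2 : ℝ) (-1 : ℝ)
      norm_num at this; exact this
    show AddCircle.liftIco 2 (-1) K ((1 : ℝ) : AddCircle (2:ℝ)) = _
    rw [h1, AddCircle.liftIco_coe_apply (by norm_num), hper]
  · show AddCircle.liftIco 2 (-1) K (u : AddCircle (2:ℝ)) = _
    rw [AddCircle.liftIco_coe_apply]
    exact ⟨hu.1, by linarith⟩

/-- pointwise Fourier expansion of the kernel on `[-1,1]`. -/
theorem hasSum_kernel (K : ℝ → ℂ) (hK : Continuous K) (hper : K (-1) = K 1)
    (hsum : Summable (fourierCoeff (⇑(kerLift K hK hper) : AddCircle (2:ℝ) → ℂ)))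
    {u : ℝ} (hu : u ∈ Icc (-1 : ℝ) 1) :
    HasSum (fun n : ℤ => fourierCoeff (⇑(kerLift K hK hper) : AddCircle (2:ℝ) → ℂ) n * cexp (π * n * u * I))
      (K u) := by
  have h := has_pointwise_sum_fourier_series_of_summable hsum (u : AddCircle (2:ℝ))
  rw [kerLift_apply K hK hper hu] at h
  have e : ∀ n : ℤ, fourierCoeff (⇑(kerLift K hK hper) : AddCircle (2:ℝ) → ℂ) n • (fourier n) (u : AddCircle (2:ℝ))
      = fourierCoeff (⇑(kerLift K hK hper) : AddCircle (2:ℝ) → ℂ) n * cexp (π * n * u * I) := by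
    intro n
    rw [smul_eq_mul, fourier_coe_apply]
    congr 1; congr 1; push_cast; ring
  simp_rw [e] at h
  exact h

/-- **ENGINE.** `∫ f K e^{ix·} = Σ_n ĉ_n · T(x + πn)`. -/
theorem hasSum_engine (K : ℝ → ℂ) (hK : Continuous K) (hper : K (-1) = K 1)
    (hsum : Summable (fun n : ℤ => ‖fourierCoeff (⇑(kerLift K hK hper) : AddCircle (2:ℝ) → ℂ) n‖))
    (f : ℝ → ℂ) (hf : Continuous f) (x : ℝ) :
    HasSum (fun n : ℤ => fourierCoeff (⇑(kerLift K hK hper) : AddCircle (2:ℝ) → ℂ) n * tfT f (x + π * n) 0)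
      (∫ u in (-1 : ℝ)..1, f u * K u * cexp (I * (x : ℂ) * u)) := by
  obtain ⟨B, hB⟩ := IsCompact.exists_bound_of_continuousOn isCompact_Icc
    (hf.continuousOn : ContinuousOn f (Icc (-1 : ℝ) 1))
  simp_rw [CoshKernel.tfT_interval]
  simp_rw [← intervalIntegral.integral_const_mul]
  have hIoc : ∀ t : ℝ, t ∈ Set.uIoc (-1 : ℝ) 1 → t ∈ Icc (-1 : ℝ) 1 := by
    intro t ht
    rw [Set.uIoc_of_le (by norm_num)] at ht
    exact ⟨ht.1.le, ht.2⟩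
  refine intervalIntegral.hasSum_integral_of_dominated_convergence
    (fun n _ => ‖fourierCoeff (⇑(kerLift K hK hper) : AddCircle (2:ℝ) → ℂ) n‖ * B) ?_ ?_ ?_ ?_ ?_
  · intro n
    apply Continuous.aestronglyMeasurable
    fun_prop
  · intro n
    refine Filter.Eventually.of_forall (fun t ht => ?_)
    rw [norm_mul, norm_mul, norm_mul, CoshKernel.norm_cexp_I_mul, mul_one, zero_mul, Real.cosh_zero,
      Complex.ofReal_one, norm_one, mul_one]
    exact mul_le_mul_of_nonneg_left (hB t (hIoc t ht)) (norm_nonneg _)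
  · exact Filter.Eventually.of_forall (fun t _ => hsum.mul_right B)
  · exact intervalIntegrable_const
  · refine Filter.Eventually.of_forall (fun t ht => ?_)
    have h := (hasSum_kernel K hK hper hsum.of_norm (hIoc t ht)).mul_left (f t * cexp (I * (x : ℂ) * t))
    have e1 : ∀ n : ℤ, fourierCoeff (⇑(kerLift K hK hper) : AddCircle (2:ℝ) → ℂ) n
          * (f t * (Real.cosh (0 * t) : ℂ) * cexp (I * ((x + π * n : ℝ) : ℂ) * t))
        = f t * cexp (I * (x : ℂ) * t)
          * (fourierCoeff (⇑(kerLift K hK hper) : AddCircle (2:ℝ) → ℂ) n * cexp (π * n * t * I)) := by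
      intro n
      rw [zero_mul, Real.cosh_zero, Complex.ofReal_one, mul_one,
        show cexp (I * ((x + π * n : ℝ) : ℂ) * t) = cexp (I * (x : ℂ) * t) * cexp (π * n * t * I) by
          rw [← Complex.exp_add]; congr 1; push_cast; ring]
      ring
    have e2 : f t * K t * cexp (I * (x : ℂ) * t) = f t * cexp (I * (x : ℂ) * t) * K t := by ring
    simp_rw [e1, e2]
    exact h

/-- **ENGINE bound.** `‖∫ f K e^{ix·}‖ ≤ (Σ‖ĉ_n‖) · sup ‖T‖`. -/
theorem norm_engine_le (K : ℝ → ℂ) (hK : Continuous K) (hper : K (-1) = K 1)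
    (hsum : Summable (fun n : ℤ => ‖fourierCoeff (⇑(kerLift K hK hper) : AddCircle (2:ℝ) → ℂ) n‖))
    (f : ℝ → ℂ) (hf : Continuous f) (M : ℝ) (hM : ∀ y : ℝ, ‖tfT f y 0‖ ≤ M) (x : ℝ) :
    ‖∫ u in (-1 : ℝ)..1, f u * K u * cexp (I * (x : ℂ) * u)‖
      ≤ (∑' n : ℤ, ‖fourierCoeff (⇑(kerLift K hK hper) : AddCircle (2:ℝ) → ℂ) n‖) * M := by
  have hs := hasSum_engine K hK hper hsum f hf x
  rw [← hs.tsum_eq]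
  have hle : ∀ n : ℤ, ‖fourierCoeff (⇑(kerLift K hK hper) : AddCircle (2:ℝ) → ℂ) n * tfT f (x + π * n) 0‖
      ≤ ‖fourierCoeff (⇑(kerLift K hK hper) : AddCircle (2:ℝ) → ℂ) n‖ * M := by
    intro n; rw [norm_mul]; exact mul_le_mul_of_nonneg_left (hM _) (norm_nonneg _)
  have hsumm : Summable (fun n : ℤ =>
      ‖fourierCoeff (⇑(kerLift K hK hper) : AddCircle (2:ℝ) → ℂ) n * tfT f (x + π * n) 0‖) :=
    Summable.of_nonneg_of_le (fun n => norm_nonneg _) hle (hsum.mul_right M)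
  calc ‖∑' n : ℤ, fourierCoeff (⇑(kerLift K hK hper) : AddCircle (2:ℝ) → ℂ) n * tfT f (x + π * n) 0‖
      ≤ ∑' n : ℤ, ‖fourierCoeff (⇑(kerLift K hK hper) : AddCircle (2:ℝ) → ℂ) n * tfT f (x + π * n) 0‖ :=
        norm_tsum_le_tsum_norm hsumm
    _ ≤ ∑' n : ℤ, ‖fourierCoeff (⇑(kerLift K hK hper) : AddCircle (2:ℝ) → ℂ) n‖ * M :=
        Summable.tsum_le_tsum hle hsumm (hsum.mul_right M)
    _ = (∑' n : ℤ, ‖fourierCoeff (⇑(kerLift K hK hper) : AddCircle (2:ℝ) → ℂ) n‖) * M := tsum_mul_right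

end engine
section ds
variable [hT : Fact ((0 : ℝ) < 2)]
/-- the Duffin–Schaeffer kernel `(sin ω + iu cos ω) e^{isu}`, `s = ω + π/2`. -/
noncomputable def dsKer (ω : ℝ) (u : ℝ) : ℂ :=
  ((Real.sin ω : ℂ) + I * u * Real.cos ω) * cexp (I * ((ω + π / 2 : ℝ) : ℂ) * u)

omit hT in
/-- `dsKer_continuous` — helper of the x-wuc GEN-11 chain «K1′(ℝ) at the stake» (verbatim from the referee-passed extract `SplitXWucK1R.lean` 70c8eb2af2868881; role: see the module docstring). -/
theorem dsKer_continuous (ω : ℝ) : Continuous (dsKer ω) := by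
  unfold dsKer; fun_prop

omit hT in
/-- `cexp_I_s` — helper of the x-wuc GEN-11 chain «K1′(ℝ) at the stake» (verbatim from the referee-passed extract `SplitXWucK1R.lean` 70c8eb2af2868881; role: see the module docstring). -/
theorem cexp_I_s (ω : ℝ) : cexp (I * ((ω + π / 2 : ℝ) : ℂ) * (1 : ℝ)) = (((-Real.sin ω : ℝ) : ℂ)) + (Real.cos ω : ℂ) * I := by
  rw [Complex.ofReal_one, mul_one, mul_comm I, Complex.exp_mul_I, ← Complex.ofReal_cos, ← Complex.ofReal_sin,
    Real.cos_add_pi_div_two, Real.sin_add_pi_div_two]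

omit hT in
/-- `cexp_I_s_neg` — helper of the x-wuc GEN-11 chain «K1′(ℝ) at the stake» (verbatim from the referee-passed extract `SplitXWucK1R.lean` 70c8eb2af2868881; role: see the module docstring). -/
theorem cexp_I_s_neg (ω : ℝ) : cexp (I * ((ω + π / 2 : ℝ) : ℂ) * (-1 : ℝ)) = (((-Real.sin ω : ℝ) : ℂ)) - (Real.cos ω : ℂ) * I := by
  rw [show I * ((ω + π / 2 : ℝ) : ℂ) * ((-1 : ℝ) : ℂ) = ((-(ω + π / 2) : ℝ) : ℂ) * I by push_cast; ring,
    Complex.exp_mul_I, ← Complex.ofReal_cos, ← Complex.ofReal_sin, Real.cos_neg, Real.sin_neg,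
    Real.cos_add_pi_div_two, Real.sin_add_pi_div_two]
  push_cast; ring

omit hT in
/-- `dsKer_one` — helper of the x-wuc GEN-11 chain «K1′(ℝ) at the stake» (verbatim from the referee-passed extract `SplitXWucK1R.lean` 70c8eb2af2868881; role: see the module docstring). -/
theorem dsKer_one (ω : ℝ) : dsKer ω 1 = -1 := by
  have h' : ((Real.sin ω : ℂ)) ^ 2 + ((Real.cos ω : ℂ)) ^ 2 = 1 := by exact_mod_cast Real.sin_sq_add_cos_sq ω
  unfold dsKer
  rw [cexp_I_s]; simp only [Complex.ofReal_neg, Complex.ofReal_one, mul_one]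
  linear_combination (-1 : ℂ) * h' + (Real.cos ω : ℂ) ^ 2 * Complex.I_sq

omit hT in
/-- `dsKer_neg_one` — helper of the x-wuc GEN-11 chain «K1′(ℝ) at the stake» (verbatim from the referee-passed extract `SplitXWucK1R.lean` 70c8eb2af2868881; role: see the module docstring). -/
theorem dsKer_neg_one (ω : ℝ) : dsKer ω (-1) = -1 := by
  have h' : ((Real.sin ω : ℂ)) ^ 2 + ((Real.cos ω : ℂ)) ^ 2 = 1 := by exact_mod_cast Real.sin_sq_add_cos_sq ω
  unfold dsKer
  rw [cexp_I_s_neg]; simp only [Complex.ofReal_neg, Complex.ofReal_one, mul_neg, mul_one, neg_mul]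
  linear_combination (-1 : ℂ) * h' + (Real.cos ω : ℂ) ^ 2 * Complex.I_sq

omit hT in
/-- `dsKer_per` — helper of the x-wuc GEN-11 chain «K1′(ℝ) at the stake» (verbatim from the referee-passed extract `SplitXWucK1R.lean` 70c8eb2af2868881; role: see the module docstring). -/
theorem dsKer_per (ω : ℝ) : dsKer ω (-1) = dsKer ω 1 := by rw [dsKer_one, dsKer_neg_one]

/-- the Fourier coefficients of the DS kernel. -/
noncomputable def dsCoeff (ω : ℝ) (n : ℤ) : ℝ :=
  -(Real.cos ω) ^ 2 * Real.cos (π * n) / (ω + π / 2 - π * n) ^ 2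

omit hT in
/-- `shift_ne_zero` — helper of the x-wuc GEN-11 chain «K1′(ℝ) at the stake» (verbatim from the referee-passed extract `SplitXWucK1R.lean` 70c8eb2af2868881; role: see the module docstring). -/
theorem shift_ne_zero {ω : ℝ} (hω : Real.cos ω ≠ 0) (n : ℤ) : ω + π / 2 - π * n ≠ 0 := by
  intro h
  apply hω
  have : ω = π * n - π / 2 := by linarith
  rw [this, Real.cos_sub_pi_div_two, mul_comm]
  exact Real.sin_int_mul_pi n

omit hT in
/-- `sin_shift` — helper of the x-wuc GEN-11 chain «K1′(ℝ) at the stake» (verbatim from the referee-passed extract `SplitXWucK1R.lean` 70c8eb2af2868881; role: see the module docstring). -/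
theorem sin_shift (ω : ℝ) (n : ℤ) : Real.sin (ω + π / 2 - π * n) = Real.cos ω * Real.cos (π * n) := by
  rw [Real.sin_sub, Real.sin_add_pi_div_two, Real.cos_add_pi_div_two,
    show (π * n : ℝ) = n * π by ring, Real.sin_int_mul_pi]
  ring

omit hT in
/-- `cos_shift` — helper of the x-wuc GEN-11 chain «K1′(ℝ) at the stake» (verbatim from the referee-passed extract `SplitXWucK1R.lean` 70c8eb2af2868881; role: see the module docstring). -/
theorem cos_shift (ω : ℝ) (n : ℤ) : Real.cos (ω + π / 2 - π * n) = -Real.sin ω * Real.cos (π * n) := by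
  rw [Real.cos_sub, Real.sin_add_pi_div_two, Real.cos_add_pi_div_two,
    show (π * n : ℝ) = n * π by ring, Real.sin_int_mul_pi]
  ring

omit hT in
/-- the basic integral: `∫_{-1}^{1} e^{-iπnu} dsKer ω u du = -2 cos²ω cos(πn)/(s-πn)²`. -/
theorem integral_exp_mul_dsKer {ω : ℝ} (hω : Real.cos ω ≠ 0) (n : ℤ) :
    ∫ u in (-1 : ℝ)..1, cexp (-(π * n * I) * u) * dsKer ω u
      = ((-2 * (Real.cos ω) ^ 2 * Real.cos (π * n) / (ω + π / 2 - π * n) ^ 2 : ℝ) : ℂ) := by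
  set m : ℝ := ω + π / 2 - π * n with hm_def
  have hm : m ≠ 0 := shift_ne_zero hω n
  have hmC : (m : ℂ) ≠ 0 := Complex.ofReal_ne_zero.mpr hm
  set A : ℂ := (Real.sin ω : ℂ) with hA
  set C : ℂ := (Real.cos ω : ℂ) with hC
  -- combine the exponentials
  have hcongr : EqOn (fun u : ℝ => cexp (-(π * n * I) * u) * dsKer ω u)
      (fun u : ℝ => (A + I * u * C) * cexp (I * (m : ℂ) * u)) (uIcc (-1 : ℝ) 1) := by
    intro u _
    simp only [dsKer, hA, hC, hm_def]
    rw [mul_left_comm, ← Complex.exp_add]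
    congr 2; push_cast; ring
  rw [intervalIntegral.integral_congr hcongr]
  -- antiderivative
  set G : ℝ → ℂ := fun u => cexp (I * (m : ℂ) * u) * (-I * (A + I * u * C) / m + I * C / (m : ℂ) ^ 2) with hG
  have hGderiv : ∀ u : ℝ, HasDerivAt G ((A + I * u * C) * cexp (I * (m : ℂ) * u)) u := by
    intro u
    have hlin : HasDerivAt (fun u : ℝ => I * (m : ℂ) * (u : ℂ)) (I * (m : ℂ) * 1) u :=
      (hasDerivAt_id u).ofReal_comp.const_mul (I * (m : ℂ))
    have h1 : HasDerivAt (fun u : ℝ => cexp (I * (m : ℂ) * u)) (cexp (I * (m : ℂ) * u) * (I * (m : ℂ) * 1)) u :=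
      hlin.cexp
    have hlin2 : HasDerivAt (fun u : ℝ => A + I * (u : ℂ) * C) (I * 1 * C) u := by
      have : HasDerivAt (fun u : ℝ => I * (u : ℂ) * C) (I * 1 * C) u :=
        ((hasDerivAt_id u).ofReal_comp.const_mul I).mul_const C
      exact this.const_add A
    have h2 : HasDerivAt (fun u : ℝ => -I * (A + I * u * C) / m + I * C / (m : ℂ) ^ 2)
        (-I * (I * 1 * C) / m + 0) u :=
      ((hlin2.const_mul (-I)).div_const (m : ℂ)).add (hasDerivAt_const u _)
    have h3 := h1.mul h2
    refine h3.congr_deriv ?_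
    have hI3 : I ^ 3 = -I := by rw [pow_succ, Complex.I_sq]; ring
    field_simp
    linear_combination (-(m : ℂ) * u * C) * hI3 + (-(m : ℂ) * A) * Complex.I_sq
  have hint : IntervalIntegrable (fun u : ℝ => (A + I * u * C) * cexp (I * (m : ℂ) * u)) volume (-1) 1 := by
    apply Continuous.intervalIntegrable; fun_prop
  rw [intervalIntegral.integral_eq_sub_of_hasDerivAt (fun u _ => hGderiv u) hint]
  have he1 : cexp (I * (m : ℂ) * (1 : ℝ)) = (Real.cos m : ℂ) + (Real.sin m : ℂ) * I := by
    rw [Complex.ofReal_one, mul_one, mul_comm I, Complex.exp_mul_I, ← Complex.ofReal_cos, ← Complex.ofReal_sin]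
  have he2 : cexp (I * (m : ℂ) * (-1 : ℝ)) = (Real.cos m : ℂ) - (Real.sin m : ℂ) * I := by
    rw [show I * (m : ℂ) * ((-1 : ℝ) : ℂ) = ((-m : ℝ) : ℂ) * I by push_cast; ring, Complex.exp_mul_I,
      ← Complex.ofReal_cos, ← Complex.ofReal_sin, Real.cos_neg, Real.sin_neg]
    push_cast; ring
  have hsin : (Real.sin m : ℂ) = C * Real.cos (π * n) := by
    rw [hC, hm_def, sin_shift]; push_cast; ring
  have hcos : (Real.cos m : ℂ) = -A * Real.cos (π * n) := by
    rw [hA, hm_def, cos_shift]; push_cast; ring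
  simp only [hG]
  rw [he1, he2, hsin, hcos,
    show ((-2 * Real.cos ω ^ 2 * Real.cos (π * n) / m ^ 2 : ℝ) : ℂ)
      = -2 * C ^ 2 * (Real.cos (π * n) : ℂ) / (m : ℂ) ^ 2 by rw [hC]; push_cast; ring]
  simp only [Complex.ofReal_neg, Complex.ofReal_one]
  linear_combination (2 * C ^ 2 * (Real.cos (π * n) : ℂ) / (m : ℂ) ^ 2) * Complex.I_sq

/-- `fourierCoeff_dsKer` — helper of the x-wuc GEN-11 chain «K1′(ℝ) at the stake» (verbatim from the referee-passed extract `SplitXWucK1R.lean` 70c8eb2af2868881; role: see the module docstring). -/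
theorem fourierCoeff_dsKer {ω : ℝ} (hω : Real.cos ω ≠ 0) (n : ℤ) :
    fourierCoeff (⇑(kerLift (dsKer ω) (dsKer_continuous ω) (dsKer_per ω)) : AddCircle (2:ℝ) → ℂ) n
      = (dsCoeff ω n : ℂ) := by
  rw [fourierCoeff_eq_intervalIntegral _ n (-1)]
  have hcongr : EqOn (fun x : ℝ => (fourier (-n)) (x : AddCircle (2:ℝ))
        • (kerLift (dsKer ω) (dsKer_continuous ω) (dsKer_per ω)) (x : AddCircle (2:ℝ)))
      (fun x : ℝ => cexp (-(π * n * I) * x) * dsKer ω x) (uIcc (-1 : ℝ) (-1 + 2)) := by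
    intro x hx
    rw [uIcc_of_le (by norm_num)] at hx
    have hx' : x ∈ Icc (-1 : ℝ) 1 := ⟨hx.1, by linarith [hx.2]⟩
    simp only [smul_eq_mul]
    rw [kerLift_apply _ _ _ hx', fourier_coe_apply]
    congr 1; congr 1; push_cast; ring
  rw [intervalIntegral.integral_congr hcongr, show (-1 : ℝ) + 2 = 1 by norm_num,
    integral_exp_mul_dsKer hω n]
  simp only [dsCoeff]
  rw [Complex.real_smul]; push_cast; ring

omit hT in
/-- `norm_dsCoeff` — helper of the x-wuc GEN-11 chain «K1′(ℝ) at the stake» (verbatim from the referee-passed extract `SplitXWucK1R.lean` 70c8eb2af2868881; role: see the module docstring). -/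
theorem norm_dsCoeff {ω : ℝ} (hω : Real.cos ω ≠ 0) (n : ℤ) :
    ‖(dsCoeff ω n : ℂ)‖ = (Real.cos ω) ^ 2 / (ω + π / 2 - π * n) ^ 2 := by
  have hm := shift_ne_zero hω n
  have h1 : |Real.cos (π * n)| = 1 := by
    have hs : Real.sin (π * n) = 0 := by rw [mul_comm]; exact Real.sin_int_mul_pi n
    have h := Real.sin_sq_add_cos_sq (π * n)
    rw [hs] at h
    have h2 : |Real.cos (π * n)| ^ 2 = 1 := by rw [sq_abs]; linarith
    nlinarith [abs_nonneg (Real.cos (π * n))]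
  rw [Complex.norm_real, Real.norm_eq_abs, dsCoeff, abs_div, abs_mul, abs_neg, abs_of_nonneg (sq_nonneg _),
    h1, mul_one, abs_of_pos (by positivity)]

end ds
end DSLine
end Summit.RiemannHypothesis.RiemannHypothesis.Theorems.Splittings.XWucG8
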